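import Summits.SmoothPoincare4.Statement
import Literature.Topology.FourManifolds.ConnectedSum
import Literature.Topology.FourManifolds.SmoothOrientationDiffeomorphProofs
import Literature.Topology.FourManifolds.SmoothOrientationSphereProofs
import Literature.Topology.FourManifolds.OrientedConnectedSumAssoc
import Literature.Topology.FourManifolds.OrientedConnectedSumSphereSelf
import Literature.Topology.FourManifolds.BordismMerging
import Literature.Topology.FourManifolds.CerfGammaFourProofs
import Literature.Topology.FourManifolds.HomotopyS4CompactProofs

/-!
# The bet of line `embed-dont-dissolve` is implied by SPC4 (negative/position lemmas for crux stmt-SmoothPoincare4-0368)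

Crux `ZeroSurgeryExotic.ZseSVanishesOnPairs` (item `stmt-SmoothPoincare4-0368`).  The picked line
`embed-dont-dissolve` (`Cruxes/ZseSVanishesOnPairs/Lines/embed-dont-dissolve.lean`, `PICKED.md` of
2026-08-16T02:48Z) bets (`stub_puncturedPairSphereEmbeds`): for one chirality `o` of `ℂℙ²`, every
Manolescu–Piccirillo pair-sphere datum `(X ≃ₕ S⁴, oX, q, …)` has its puncture `(X ∖ {q}, oX)` embedded
orientation-preservingly in an `o`-tower `#ⁿ(ℂℙ², o)`; height `0` of a tower is "`P ≃ₘ S⁴`".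

This file (deep-refute seat on the stub set) records, DEF-FREE over tree vocabulary, why that bet cannot be
refuted by anything short of an exotic 4-sphere:

* `exists_orientationPreserving_embedding_puncture_of_diffeomorph_sphere` — UNCONDITIONAL: if `X` is
  diffeomorphic to `S⁴`, then for EVERY smooth orientation `oX` and EVERY point `q` the punctured
  `(X ∖ {q}, oX)` embeds smoothly and orientation-preservingly in `S⁴` for a suitable orientation of `S⁴`
  (the diffeomorphism preserves or reverses any pair of orientations, `X` being connected — tree theorem
  `Diffeomorph.isOrientationPreserving_or_isOrientationReversing_holds` — so flip the target orientation
  if needed; compose with the open inclusion).  This is the height-`0` witness of the skeleton's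
  `PuncturedEmbedsInTower o X oX q` for BOTH chiralities `o` (`IsTower o 0 S⁴ oS := ⟨Diffeomorph.refl⟩`).
* `exists_orientationPreserving_embedding_puncture_of_spc4` — hence `SmoothPoincare4` gives the bet's
  conclusion for every datum and every chirality: the `∃ o` of the stub adds nothing under SPC4, a
  refutation of the bet (for either `o`) exhibits a closed smooth homotopy 4-sphere not diffeomorphic to
  `S⁴`, and no printed invariant obstructs it (it is weaker than one-sided dissolution, MMSW Question 9.12).
No definitions; no route item is concluded.
-/

noncomputable section

set_option linter.dupNamespace false

open scoped Manifold ContDiff Topology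
open Set Function ContinuousMap
open Literature.Topology.FourManifolds

namespace Summit.SmoothPoincare4.SmoothPoincare4.Theorems.ZseSVanishesOnPairs.Negative

/-- **A manifold diffeomorphic to `S⁴` has its punctures embedded orientation-preservingly in `S⁴`.**
For a closed smooth `X`, a diffeomorphism `φ : X ≃ₘ S⁴`, any smooth orientation `oX` of `X` and any point
`q`, there are an orientation `oS` of `S⁴` and a smooth embedding `j : X ∖ {q} ↪ S⁴` (namely `φ` restricted)
which is orientation preserving from `oX|_{X ∖ {q}}` to `oS`.  Height-`0` case of the bet of line
`embed-dont-dissolve`, for both chiralities. [cite: HirschDT1976, §4.4 p. 101] -/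
theorem exists_orientationPreserving_embedding_puncture_of_diffeomorph_sphere {X : Type}
    [TopologicalSpace X] [T2Space X] [SecondCountableTopology X]
    [ChartedSpace (EuclideanSpace ℝ (Fin 4)) X] [IsManifold (𝓡 4) ∞ X]
    (φ : X ≃ₘ⟮𝓡 4, 𝓡 4⟯ (Metric.sphere (0 : EuclideanSpace ℝ (Fin 5)) 1))
    (oX : SmoothOrientation (𝓡 4) X) (q : X) :
    ∃ (oS : SmoothOrientation (𝓡 4) (Metric.sphere (0 : EuclideanSpace ℝ (Fin 5)) 1))
      (j : ↥((⟨{q}ᶜ, isOpen_compl_singleton⟩ : TopologicalSpace.Opens X)) →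
        (Metric.sphere (0 : EuclideanSpace ℝ (Fin 5)) 1)),
      Manifold.IsSmoothEmbedding (𝓡 4) (𝓡 4) ∞ j ∧
        IsOrientationPreserving
          (oX.restrict ((⟨{q}ᶜ, isOpen_compl_singleton⟩ : TopologicalSpace.Opens X))) oS j ∧
        ∀ x, j x = φ x := by
  haveI : PathConnectedSpace (Metric.sphere (0 : EuclideanSpace ℝ (Fin 5)) 1) :=
    pathConnectedSpace_sphere_four
  haveI : PathConnectedSpace X := pathConnectedSpace_of_homotopyEquiv φ.toHomeomorph.toHomotopyEquiv
  obtain ⟨oS₀⟩ := isOrientable_sphere_holds 4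
  have key : ∃ oS : SmoothOrientation (𝓡 4) (Metric.sphere (0 : EuclideanSpace ℝ (Fin 5)) 1),
      IsOrientationPreserving oX oS φ := by
    rcases Diffeomorph.isOrientationPreserving_or_isOrientationReversing_holds
        (φ := φ) (by simp) oX oS₀ with h | h
    · exact ⟨oS₀, h⟩
    · exact ⟨-oS₀, h⟩
  obtain ⟨oS, hoS⟩ := key
  set U : TopologicalSpace.Opens X := ⟨{q}ᶜ, isOpen_compl_singleton⟩
  refine ⟨oS, φ ∘ (Subtype.val : U → X), ?_, ?_, fun x ↦ rfl⟩
  · refine IsSmoothEmbedding.comp_of_isOpen_range (Diffeomorph.isSmoothEmbedding' φ)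
      (Manifold.IsSmoothEmbedding.of_opens U) ?_
    rw [Subtype.range_coe]
    exact U.2
  · refine IsOrientationPreserving.comp_holds hoS (isOrientationPreserving_subtype_val oX U)
      (φ.contMDiff.mdifferentiable (by simp))
      ((contMDiff_subtype_val : ContMDiff (𝓡 4) (𝓡 4) ∞ (Subtype.val : U → X)).mdifferentiable
        (by simp)) (fun y ↦ φ.det_mfderiv_ne_zero (by simp) y) ?_
    intro x
    rw [det_mfderiv_subtype_val]
    exact one_ne_zero

/-- **Under `SmoothPoincare4` every punctured homotopy 4-sphere embeds orientation-preservingly in `S⁴`**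
(for every orientation and every puncture point): the conclusion of the bet `stub_puncturedPairSphereEmbeds`
of line `embed-dont-dissolve` at tower height `0`, for EVERY chirality and without using any of the pair
data — so the bet is sandwiched `SPC4 ⇒ bet ⇒ (with MMSW Cor. 1.9) crux`, and refuting it means exhibiting
an exotic `S⁴`. [cite: Kirby1997, Problem 4.89] -/
theorem exists_orientationPreserving_embedding_puncture_of_spc4 (hS : _root_.SmoothPoincare4)
    {X : Type} [TopologicalSpace X] [T2Space X] [SecondCountableTopology X]
    [ChartedSpace (EuclideanSpace ℝ (Fin 4)) X] [IsManifold (𝓡 4) ∞ X]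
    (hX : Nonempty (X ≃ₕ (Metric.sphere (0 : EuclideanSpace ℝ (Fin 5)) 1)))
    (oX : SmoothOrientation (𝓡 4) X) (q : X) :
    ∃ (oS : SmoothOrientation (𝓡 4) (Metric.sphere (0 : EuclideanSpace ℝ (Fin 5)) 1))
      (j : ↥((⟨{q}ᶜ, isOpen_compl_singleton⟩ : TopologicalSpace.Opens X)) →
        (Metric.sphere (0 : EuclideanSpace ℝ (Fin 5)) 1)),
      Manifold.IsSmoothEmbedding (𝓡 4) (𝓡 4) ∞ j ∧
        IsOrientationPreserving
          (oX.restrict ((⟨{q}ᶜ, isOpen_compl_singleton⟩ : TopologicalSpace.Opens X))) oS j := by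
  obtain ⟨φ⟩ := hS X ‹_› ‹_› hX.some
  obtain ⟨oS, j, hj, hjo, -⟩ :=
    exists_orientationPreserving_embedding_puncture_of_diffeomorph_sphere φ oX q
  exact ⟨oS, j, hj, hjo⟩

end Summit.SmoothPoincare4.SmoothPoincare4.Theorems.ZseSVanishesOnPairs.Negative
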